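import Summits.KontsevichZagierPeriods.KontsevichZagierPeriods.Theorems.LinRedNormalFormArrangementNormalFormSeparateTwoContract
import Summits.KontsevichZagierPeriods.KontsevichZagierPeriods.Theorems.LinRedNormalFormArrangementNormalFormSeparateTwoAdapters

/-!
# Angular contraction towards an atom direction costs a logarithm

(Line `janus-bands`, crux `ArrangementNormalForm`, stub `stub_separateTwoPos`, part
`CornerLog`.) The hypothesis `hlog` of the angular non-degeneracy lemma (part `Angular`) for the
fibre mass: in blown-up coordinates `(x, v)` at a special point (atom values
`c₀ c + x (p c + q c v)`, as in part `Corner`), at a fixed abscissa `x ≤ G/(28R)`, moving from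
the direction `v'` to `v ≤ v'` (towards the atom direction `v = 0`, `v' ≤ min(1, g/(14R))`)
multiplies the fibre mass by at most `(5 (1 + log(v'/v)))^{k·#U}` — `SepTwo.lmass_angular_log`,
registered as `separateTwo_cornerLog`. This is `SepTwo.lmass_contract` for the ray
sub-clusters (anchors = values on the ray) with contraction factor `s = v/v'`, buffer ratio
`ρ/ℓ = 2`, and the window constant `3 · wexp ℓ (2ℓ) s = 3 (1 + log(v'/v)/log 2) ≤ 5 (1 + log(v'/v))`
(`SepTwo.three_wexp_le`, from `log 2 > 0.69`).
-/

noncomputable section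

open Set MeasureTheory
open scoped ENNReal

namespace Summit.KontsevichZagierPeriods.ArrangementNormalForm.JanusBands

namespace SepTwo

variable {k : ℕ} {ι : Type*}

/-- The window constant for buffer ratio `2`: `3 · wexp ℓ (2ℓ) s ≤ 5 (1 + log(1/s))`. -/
theorem three_wexp_le {ℓ s : ℝ} (hℓ : 0 < ℓ) (hs0 : 0 < s) (hs1 : s ≤ 1) :
    3 * wexp ℓ (2 * ℓ) s ≤ 5 * (1 + Real.log s⁻¹) := by
  unfold wexp
  have h2 : 2 * ℓ / ℓ = 2 := by field_simp
  rw [h2, Real.log_inv]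
  have hlog2 : (0.6931471803 : ℝ) < Real.log 2 := Real.log_two_gt_d9
  have hl2 : 0 < Real.log 2 := by linarith
  have hL : 0 ≤ -Real.log s := by linarith [Real.log_nonpos hs0.le hs1]
  have h3 : -Real.log s / Real.log 2 ≤ 5 / 3 * (-Real.log s) := by
    rw [div_le_iff₀ hl2]; nlinarith
  have h4 : 1 - Real.log s / Real.log 2 = 1 + -Real.log s / Real.log 2 := by ring
  rw [h4]
  nlinarith

/-- **Angular contraction towards an atom direction costs a logarithm.** See the module
docstring. -/
theorem lmass_angular_log (lo hi : Fin k → Fin k ⊕ ι) (a : Fin k → Option ι) (U : Finset ι)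
    (hlo : ∀ i c, lo i = Sum.inr c → c ∈ U) (hhi : ∀ i c, hi i = Sum.inr c → c ∈ U)
    (ha : ∀ i c, a i = some c → c ∈ U) (c₀ p q : ι → ℝ) (G g R : ℝ) (hR : 0 < R)
    (hGsep : ∀ c ∈ U, ∀ c' ∈ U, c₀ c ≠ c₀ c' → G ≤ |c₀ c - c₀ c'|)
    (hgsep : ∀ c ∈ U, ∀ c' ∈ U, p c ≠ p c' → g ≤ |p c - p c'|)
    (hRp : ∀ c ∈ U, |p c| ≤ R) (hRq : ∀ c ∈ U, |q c| ≤ R)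
    {x' v v' : ℝ} (hx'0 : 0 < x') (hx' : x' ≤ G / (28 * R))
    (hv : 0 < v) (hvv' : v ≤ v') (hv'1 : v' ≤ 1) (hv'g : v' ≤ g / (14 * R)) :
    lmass lo hi a (fun c => c₀ c + x' * (p c + q c * v)) ≤
      ENNReal.ofReal (5 * (1 + Real.log (v' / v))) ^ (k * U.card) *
        lmass lo hi a (fun c => c₀ c + x' * (p c + q c * v')) := by
  have hv'0 : 0 < v' := lt_of_lt_of_le hv hvv'
  have hG28 : 28 * x' * R ≤ G := by
    have := (le_div_iff₀ (by positivity : (0 : ℝ) < 28 * R)).1 hx'; linarith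
  have hg14 : 14 * v' * R ≤ g := by
    have := (le_div_iff₀ (by positivity : (0 : ℝ) < 14 * R)).1 hv'g; linarith
  set s : ℝ := v / v' with hs_def
  have hs0 : 0 < s := div_pos hv hv'0
  have hs1 : s ≤ 1 := (div_le_one hv'0).2 hvv'
  set ℓ : ℝ := 2 * x' * R * v' with hℓ_def
  have hℓ : 0 < ℓ := by positivity
  have hw1 : 1 ≤ wexp ℓ (2 * ℓ) s := one_le_wexp ⟨hℓ, le_rfl, hs0, hs1⟩
  have hA1 : (1 : ℝ) ≤ 3 * wexp ℓ (2 * ℓ) s := by linarith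
  have hA5 : 3 * wexp ℓ (2 * ℓ) s ≤ 5 * (1 + Real.log (v' / v)) := by
    have := three_wexp_le hℓ hs0 hs1
    rwa [hs_def, inv_div] at this
  have h := lmass_contract lo hi a U hlo hhi ha (fun c => c₀ c + x' * (p c + q c * v'))
    (fun c => c₀ c + x' * (p c + q c * v)) (fun c => c₀ c + x' * p c) s ℓ (2 * ℓ)
    (3 * wexp ℓ (2 * ℓ) s) hA1 ⟨hs0, hs1⟩ ⟨hℓ, le_rfl⟩ ?_ ?_ ?_
    (fun m => hwin_of_window hℓ le_rfl hs0 hs1 m)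
  · calc lmass lo hi a (fun c => c₀ c + x' * (p c + q c * v))
        ≤ ENNReal.ofReal (3 * wexp ℓ (2 * ℓ) s) ^ (k * U.card) *
            lmass lo hi a (fun c => c₀ c + x' * (p c + q c * v')) := h
      _ ≤ ENNReal.ofReal (5 * (1 + Real.log (v' / v))) ^ (k * U.card) *
            lmass lo hi a (fun c => c₀ c + x' * (p c + q c * v')) := by
          gcongr
  · intro c hc
    show |c₀ c + x' * (p c + q c * v') - (c₀ c + x' * p c)| ≤ ℓ / 2
    rw [show c₀ c + x' * (p c + q c * v') - (c₀ c + x' * p c) = x' * (q c * v') by ring, abs_mul,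
      abs_of_pos hx'0, abs_mul, abs_of_pos hv'0, hℓ_def]
    have h1 : |q c| * v' ≤ R * v' := mul_le_mul_of_nonneg_right (hRq c hc) hv'0.le
    nlinarith
  · intro c hc c' hc' hne
    show 3 * (2 * ℓ) + ℓ ≤ |c₀ c + x' * p c - (c₀ c' + x' * p c')|
    rw [hℓ_def]
    by_cases h0 : c₀ c = c₀ c'
    · have hp : p c ≠ p c' := by
        intro hp; exact hne (by simp only [h0, hp])
      rw [show c₀ c + x' * p c - (c₀ c' + x' * p c') = x' * (p c - p c') by rw [h0]; ring, abs_mul,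
        abs_of_pos hx'0]
      have h1 := hgsep c hc c' hc' hp
      nlinarith
    · have h1 := hGsep c hc c' hc' h0
      have h2 : |x' * (p c - p c')| ≤ 2 * x' * R := by
        rw [abs_mul, abs_of_pos hx'0]
        have : |p c - p c'| ≤ R + R := (abs_sub _ _).trans (add_le_add (hRp c hc) (hRp c' hc'))
        nlinarith
      have h3 : |c₀ c - c₀ c'| - |x' * (p c - p c')| ≤ |c₀ c + x' * p c - (c₀ c' + x' * p c')| := by
        have e : c₀ c - c₀ c' = (c₀ c + x' * p c - (c₀ c' + x' * p c')) - x' * (p c - p c') := by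
          ring
        have := abs_sub (c₀ c + x' * p c - (c₀ c' + x' * p c')) (x' * (p c - p c'))
        rw [← e] at this
        linarith
      have h4 : v' * R ≤ R := by nlinarith
      nlinarith
  · intro c _
    show c₀ c + x' * (p c + q c * v) = c₀ c + x' * p c + s * (c₀ c + x' * (p c + q c * v') - (c₀ c + x' * p c))
    rw [hs_def]
    field_simp
    ring

end SepTwo

/-- **Angular contraction towards an atom direction costs a logarithm** (registered part of
`stub_separateTwoPos`; literal form of `SepTwo.lmass_angular_log`): the hypothesis `hlog` of
`separateTwo_angular` for the fibre mass in blown-up coordinates at a special point. -/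
theorem separateTwo_cornerLog (k : ℕ) (ι : Type) (lo hi : Fin k → Fin k ⊕ ι) (a : Fin k → Option ι) (U : Finset ι) (hlo : ∀ i c, lo i = Sum.inr c → c ∈ U) (hhi : ∀ i c, hi i = Sum.inr c → c ∈ U) (ha : ∀ i c, a i = some c → c ∈ U) (c₀ p q : ι → ℝ) (G g R : ℝ) (hR : 0 < R) (hGsep : ∀ c ∈ U, ∀ c' ∈ U, c₀ c ≠ c₀ c' → G ≤ |c₀ c - c₀ c'|) (hgsep : ∀ c ∈ U, ∀ c' ∈ U, p c ≠ p c' → g ≤ |p c - p c'|) (hRp : ∀ c ∈ U, |p c| ≤ R) (hRq : ∀ c ∈ U, |q c| ≤ R) (x' v v' : ℝ) (hx'0 : 0 < x') (hx' : x' ≤ G / (28 * R)) (hv : 0 < v) (hvv' : v ≤ v') (hv'1 : v' ≤ 1) (hv'g : v' ≤ g / (14 * R)) : MeasureTheory.lintegral (MeasureTheory.volume.restrict {t : Fin k → ℝ | ∀ i, Sum.elim t (fun c => c₀ c + x' * (p c + q c * v)) (lo i) < t i ∧ t i < Sum.elim t (fun c => c₀ c + x' * (p c + q c * v)) (hi i)})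 (fun t => ∏ i, (a i).elim 1 (fun c => ENNReal.ofReal |t i - (c₀ c + x' * (p c + q c * v))|⁻¹)) ≤ ENNReal.ofReal (5 * (1 + Real.log (v' / v))) ^ (k * U.card) * MeasureTheory.lintegral (MeasureTheory.volume.restrict {t : Fin k → ℝ | ∀ i, Sum.elim t (fun c => c₀ c + x' * (p c + q c * v')) (lo i) < t i ∧ t i < Sum.elim t (fun c => c₀ c + x' * (p c + q c * v')) (hi i)}) (fun t => ∏ i, (a i).elim 1 (fun c => ENNReal.ofReal |t i - (c₀ c + x' * (p c + q c * v'))|⁻¹)) := by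
  exact SepTwo.lmass_angular_log lo hi a U hlo hhi ha c₀ p q G g R hR hGsep hgsep hRp hRq hx'0 hx' hv hvv' hv'1 hv'g

end Summit.KontsevichZagierPeriods.ArrangementNormalForm.JanusBands
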